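import Summits.BirchSwinnertonDyer.Rank1Residual.X11b.KummerPoitouTateExact
import Literature.NumberTheory.GaloisRepresentations.PairingAnnihilatorOfInf
import Literature.NumberTheory.GaloisCohomology.PoitouTateSelmerStructures
import HarnessLib

/-!
# X11b, routes R1/p2 — the EXACT RELAXATION INDEX at one finite place:
# `[H¹_{𝓛, ⊤ at 𝔮}(K, E[p^k]) : Sel^{(p^k)}(E/K)] · #loc_𝔮 Sel^{(p^k)}(E/K) = #𝓛_𝔮 = #E(K_𝔮)[p^k] · #(𝓞_𝔮/p^k)`

HONEST FRAMING (cell `b2b-bsdres`, run/shared/lean/b2b/bsd-rank1-residual/, verbatim in every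
file): the goal of the cell is to DELETE the COMBINATION-SHAPED residual classes of the
Birch–Swinnerton-Dyer formula for ALL analytic-rank `≤ 1` elliptic curves over `ℚ` — "full BSD
formula for every rank `≤ 1` curve in class `C`" assembled STRICTLY from published theorems — so
that the rank-`≤ 1` remainder becomes exactly the CONSTRUCTION-SHAPED classes, which are TYPED
(missing-input `Prop`s), NOT attempted. This is not "finishing BSD". Sub-cell
`b2b-bsdres-multr1-p1` (X11b, route R1 = Castella 2018 Thm. A re-proved along the author's
erratum); a RESEARCH ROUTE; no claim beyond the stated class; X11b stays CONSTRUCTION-SHAPED;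
nothing here changes a label; no named fact is minted (theorems only; no `sorry`). CONDITIONAL on
the cited fact `poitouTate_selmerStructure_duality K` (Howard 2004 Thm. 2.1.11 ⟸ Milne I Thm.
4.10(b)) and Tate's local Euler–Poincaré characteristic `localEulerPoincareCharacteristic K_v` (Milne I
Thm. 2.8), taken as hypotheses in the `_of_facts` form.

## What is here (the Poitou–Tate step "`#im α = #coker β`" of JSW17 Prop. 3.2.1, EXACT, at finite level)

For `E = W` elliptic over a number field `K` all of whose infinite places are complex, `n = p^k`,
a finite place `𝔮`, the local pairing `b = inv_𝔮(· ∪ₑ ·)` on `H¹(K_𝔮, E[n])`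
(`Relaxation.invWeilPairing`), `KO = kummerOutside W n {𝔮} = H¹_{𝓛, ⊤ at 𝔮}(K, E[n])`,
`Sel = Sel⁽ⁿ⁾(E/K)`, `𝓛_𝔮` the local Kummer condition, `G = loc_𝔮(KO)`:

* `forall_mem_map_kummerOutside_iff` — **`G` is its own (left) annihilator**: `⊇` is the easy
  Poitou–Tate vanishing (isotropy off `𝔮`), `⊆` is `KummerPoitouTateExact.exists_mem_kummerOutside_localization_eq`
  with `S' = {𝔮}` (Howard 2.1.11 `SelmerComplement`);
* `forall_mem_kummer_invWeilPairing_eq_zero_iff` — `𝓛_𝔮` is its own (left) annihilator (the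
  tree's maximal isotropy `forall_mem_kummerSelmerStructure_weilCupProduct_eq_zero_iff_inr_of_eulerChar`
  read through the injective `inv_𝔮`);
* `map_selmerGroup_eq_inf` — `loc_𝔮(Sel) = G ⊓ 𝓛_𝔮`; `annLeft_inf_eq_sup` — Milne I Lemma 6.15 in
  linear-algebra form (`forall_mem_inf_iff_exists_add_of_self_annihilating`):
  `{}^⊥(G ⊓ 𝓛_𝔮) = G ⊔ 𝓛_𝔮`;
* **`relIndex_selmerGroup_kummerOutside_mul_natCard_map_eq`**:
  **`[KO : Sel] · #loc_𝔮(Sel) = #𝓛_𝔮`** — since `[KO : Sel] = [G ⊔ 𝓛_𝔮 : 𝓛_𝔮]` (`Sel = KO ∩ loc⁻¹𝓛_𝔮`)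
  and `#(G ⊔ 𝓛_𝔮) · #(G ⊓ 𝓛_𝔮) = #{}^⊥(G ⊓ 𝓛_𝔮) · #(G ⊓ 𝓛_𝔮) = #H¹(K_𝔮, E[n]) = #𝓛_𝔮²`
  (`FiniteDuality.natCard_annLeft_mul`, Tate's count);
* **`relIndex_selmerGroup_kummerOutside_mul_natCard_map_eq_of_facts`**: the same with right side
  `#E(K_𝔮)[p^k] · #(𝓞_𝔮/p^k)` from the two NAMED facts (`poitouTate_selmerStructure_duality K`,
  `localEulerPoincareCharacteristic K_v`), `k ≥ 1`.

Route p2's Part B (`Relaxation.relIndex_selmerGroup_kummerOutside_le`) is the inequality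
`[KO : Sel] ≤ [𝓛_𝔮 : loc_𝔮 κ(E(K))]` obtained by shrinking `loc_𝔮 Sel` to `loc_𝔮 κ(E(K))`; here the
index is EXACT.  Consumer: the exact count of Castella's `Sel_𝔭(K, E[p^∞])` at `𝔮 = 𝔭̄` (atom (P6)
`BaseSelmerCountAt`; multr1-p2's `KummerTorsionDecomposition` supplies `#loc_𝔮 Sel^{(p^k)} = p^{k−e}`
at a deep level).

References: [JetchevSkinnerWan2017] Prop. 3.2.1 (proof, arXiv:1512.06894 pp. 10–11);
[Howard2004HeegnerKolyvagin] Thm. 2.1.11 (arXiv:1202.6340 p. 6); [MilneADT2006] I Cor. 2.3,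
Thm. 2.8, Cor. 3.4, Thm. 4.10(b), Lemma 6.15.
-/

noncomputable section

open scoped Classical

open CategoryTheory Field NumberField IsDedekindDomain Function
open Literature.NumberTheory.EllipticCurves Literature.NumberTheory.EllipticCurves.GreenbergSelmer
open Literature.NumberTheory.GaloisRepresentations
open Literature.NumberTheory.GaloisRepresentations.DiscreteGaloisModule (SelmerStructure TateDual
  tateDual localTatePairingZMod unramifiedSubgroup mu MuCarrier)
open Literature.NumberTheory.GaloisCohomology
open scoped ContRepresentation

namespace Summit.BirchSwinnertonDyer.Rank1Residual.X11b.KummerPT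

open Summit.BirchSwinnertonDyer.Rank1Residual.X11b.LocBridge
open Summit.BirchSwinnertonDyer.Rank1Residual.X11b.Levels
open Summit.BirchSwinnertonDyer.Rank1Residual.X11b.AcSelmer
open Summit.BirchSwinnertonDyer.Rank1Residual.X11b.FiniteDuality
open Summit.BirchSwinnertonDyer.Rank1Residual.X11b.Relaxation

-- Cup products need `LocallyCompactSpace Γ`; finiteness of `E[p^k]`, `NeZero (p^k)`: local instances.
attribute [local instance] absoluteGaloisGroup_compactSpace Levels.neZero_pow finite_geomTorsion_pow
  finite_geomTorsion_of_neZero Literature.NumberTheory.EllipticCurves.finite_muCarrier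

variable {K : Type} [Field K] [NumberField K] (W : WeierstrassCurve K) [W.IsElliptic] (p k : ℕ)
  [Fact p.Prime]

section OnePlace

variable (e : W.geomTorsion ((p ^ k : ℕ) : ℤ) → W.geomTorsion ((p ^ k : ℕ) : ℤ) → AlgebraicClosure K)
  (hμ : ∀ S T, e S T ^ (p ^ k) = 1)
  (hadd₁ : ∀ S₁ S₂ T, e (S₁ + S₂) T = e S₁ T * e S₂ T)
  (hadd₂ : ∀ S T₁ T₂, e S (T₁ + T₂) = e S T₁ * e S T₂)
  (hgal : ∀ (σ : absoluteGaloisGroup K) (S T : W.geomTorsion ((p ^ k : ℕ) : ℤ)),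
    σ • e S T = e (σ • S) (σ • T))
  (halt : ∀ T, e T T = 1) (hnondeg : ∀ T, (∀ S, e S T = 1) → T = 0)
  (𝔮 : HeightOneSpectrum (𝓞 K))

include halt hnondeg in
/-- **`loc_𝔮(kummerOutside W (p^k) {𝔮})` is its own annihilator in `H¹(K_𝔮, E[p^k])`** (left form, for
`inv_𝔮(· ∪ₑ ·)`): for a local class `t`, `inv_𝔮(t ∪ₑ loc_𝔮 c) = 0` for all `c ∈ H¹_{𝓛, ⊤ at 𝔮}` iff
`t = loc_𝔮 x` for some `x ∈ H¹_{𝓛, ⊤ at 𝔮}`.  `⇐`: Poitou–Tate vanishing with isotropy off `𝔮`;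
`⇒`: `exists_mem_kummerOutside_localization_eq` with `S' = {𝔮}`.  (Milne I Thm. 4.10(b),
`Im β¹ = Ker γ¹` for `S = {𝔮}` and `M = E[p^k]`.) [cite: MilneADT2006, Ch. I, Thm. 4.10(b)]
[cite: Howard2004HeegnerKolyvagin, Thm. 2.1.11 (arXiv:1202.6340 p. 6)] -/
theorem forall_mem_map_kummerOutside_iff (hK : ∀ w : InfinitePlace K, w.IsComplex)
    {inv : LocalInvariants K (p ^ k)} (hperf : inv.IsPerfect) (hsum : inv.SumLocalTermEqZero)
    (hcompl : inv.SelmerComplement)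
    (hEuler : ∀ v : HeightOneSpectrum (𝓞 K),
      Nat.card (galoisCohomology ((W.torsionGaloisModule ((p ^ k : ℕ) : ℤ)).toLocal (Sum.inr v)) 1) =
        (Nat.card (nsmulAddMonoidHom (p ^ k) :
            (W.baseChange (v.adicCompletion K)).toAffine.Point →+ _).ker *
          Nat.card (v.adicCompletionIntegers K ⧸
            Ideal.span {((p ^ k : ℕ) : v.adicCompletionIntegers K)})) ^ 2)
    (t : galoisCohomology ((W.torsionGaloisModule ((p ^ k : ℕ) : ℤ)).toLocal (Sum.inr 𝔮)) 1) :
    (∀ g ∈ (kummerOutside W (p ^ k) {Sum.inr 𝔮}).map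
        (galoisCohomology.localization (W.torsionGaloisModule ((p ^ k : ℕ) : ℤ)) (Sum.inr 𝔮) 1),
      invWeilPairing W (p ^ k) e hμ hadd₁ hadd₂ hgal inv (Sum.inr 𝔮) t g = 0) ↔
    t ∈ (kummerOutside W (p ^ k) {Sum.inr 𝔮}).map
        (galoisCohomology.localization (W.torsionGaloisModule ((p ^ k : ℕ) : ℤ)) (Sum.inr 𝔮) 1) := by
  classical
  constructor
  · intro h
    set tfam : Π v : Place K, galoisCohomology ((W.torsionGaloisModule ((p ^ k : ℕ) : ℤ)).toLocal v) 1 :=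
      Pi.single (Sum.inr 𝔮) t with htfam
    obtain ⟨x, hx, hxt⟩ := exists_mem_kummerOutside_localization_eq W p k e hμ hadd₁ hadd₂ hgal halt
      hnondeg hK hperf hcompl hEuler {Sum.inr 𝔮} tfam (fun c hc ↦ by
        rw [Finset.sum_singleton, htfam, Pi.single_eq_same]
        exact h _ ⟨c, hc, rfl⟩)
    refine ⟨x, hx, ?_⟩
    rw [hxt _ (Finset.mem_singleton_self _), htfam, Pi.single_eq_same]
  · rintro ⟨x, hx, rfl⟩ g ⟨c, hc, rfl⟩
    have h := sum_invWeilPairing_localization_eq_zero_of_mem_kummerOutside W (p ^ k) e hμ hadd₁ hadd₂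
      hgal halt inv hsum {Sum.inr 𝔮} hx hc
    rwa [Finset.sum_singleton] at h

include halt hnondeg in
/-- **`𝓛_𝔮` is its own annihilator for `inv_𝔮(· ∪ₑ ·)`** (left form): the tree's maximal isotropy of
the local Kummer condition for the Weil cup product
(`forall_mem_kummerSelmerStructure_weilCupProduct_eq_zero_iff_inr_of_eulerChar`, from Tate's count),
read through the injective `inv_𝔮`. [cite: MilneADT2006, Ch. I, Cor. 3.4 and Lemma 6.15]
[cite: PoonenRains2012, Prop. 4.10] -/
theorem forall_mem_kummer_invWeilPairing_eq_zero_iff {inv : LocalInvariants K (p ^ k)}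
    (hinv : Injective (inv (Sum.inr 𝔮)))
    (hEuler : Nat.card (galoisCohomology ((W.torsionGaloisModule ((p ^ k : ℕ) : ℤ)).toLocal (Sum.inr 𝔮)) 1) =
      (Nat.card (nsmulAddMonoidHom (p ^ k) :
          (W.baseChange (𝔮.adicCompletion K)).toAffine.Point →+ _).ker *
        Nat.card (𝔮.adicCompletionIntegers K ⧸
          Ideal.span {((p ^ k : ℕ) : 𝔮.adicCompletionIntegers K)})) ^ 2)
    (t : galoisCohomology ((W.torsionGaloisModule ((p ^ k : ℕ) : ℤ)).toLocal (Sum.inr 𝔮)) 1) :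
    (∀ y ∈ W.kummerSelmerStructure ((p ^ k : ℕ) : ℤ) (Sum.inr 𝔮),
      invWeilPairing W (p ^ k) e hμ hadd₁ hadd₂ hgal inv (Sum.inr 𝔮) t y = 0) ↔
    t ∈ W.kummerSelmerStructure ((p ^ k : ℕ) : ℤ) (Sum.inr 𝔮) := by
  rw [← forall_mem_kummerSelmerStructure_weilCupProduct_eq_zero_iff_inr_of_eulerChar W 𝔮 (p ^ k) e hμ
    hadd₁ hadd₂ hgal halt hnondeg hEuler t]
  refine forall₂_congr fun y _ ↦ ?_
  rw [invWeilPairing_apply]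
  exact map_eq_zero_iff (inv (Sum.inr 𝔮)) hinv

omit [W.IsElliptic] [Fact p.Prime] in
/-- `Sel⁽ⁿ⁾ = loc_𝔮⁻¹(𝓛_𝔮) ∩ kummerOutside W n {𝔮}` (the Kummer condition at `𝔮` and everywhere else).
[folklore] -/
theorem selmerGroup_eq_comap_inf_kummerOutside :
    W.selmerGroup ((p ^ k : ℕ) : ℤ) =
      (W.kummerSelmerStructure ((p ^ k : ℕ) : ℤ) (Sum.inr 𝔮)).comap
          (galoisCohomology.localization (W.torsionGaloisModule ((p ^ k : ℕ) : ℤ)) (Sum.inr 𝔮) 1) ⊓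
        kummerOutside W (p ^ k) {Sum.inr 𝔮} := by
  apply le_antisymm
  · intro c hc
    exact ⟨(W.mem_selmerGroup_iff_forall_localization_mem _ c).mp hc (Sum.inr 𝔮),
      selmerGroup_le_kummerOutside W (p ^ k) _ hc⟩
  · rintro c ⟨hc₀, hcKO⟩
    refine mem_selmerGroup_of_mem_kummerOutside W (p ^ k) hcKO fun v ↦ ?_
    obtain ⟨v, hv⟩ := v
    rw [Finset.mem_singleton] at hv
    subst hv
    exact hc₀

omit [W.IsElliptic] [Fact p.Prime] in
/-- **`loc_𝔮(Sel⁽ⁿ⁾) = loc_𝔮(kummerOutside W n {𝔮}) ∩ 𝓛_𝔮`.** [folklore] -/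
theorem map_selmerGroup_eq_inf :
    (W.selmerGroup ((p ^ k : ℕ) : ℤ)).map
        (galoisCohomology.localization (W.torsionGaloisModule ((p ^ k : ℕ) : ℤ)) (Sum.inr 𝔮) 1) =
      (kummerOutside W (p ^ k) {Sum.inr 𝔮}).map
          (galoisCohomology.localization (W.torsionGaloisModule ((p ^ k : ℕ) : ℤ)) (Sum.inr 𝔮) 1) ⊓
        W.kummerSelmerStructure ((p ^ k : ℕ) : ℤ) (Sum.inr 𝔮) := by
  rw [selmerGroup_eq_comap_inf_kummerOutside W p k 𝔮]
  ext y
  constructor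
  · rintro ⟨c, ⟨hcL, hcKO⟩, rfl⟩
    exact ⟨⟨c, hcKO, rfl⟩, hcL⟩
  · rintro ⟨⟨c, hcKO, rfl⟩, hyL⟩
    exact ⟨c, ⟨hyL, hcKO⟩, rfl⟩

include halt hnondeg in
/-- **Milne I Lemma 6.15 at the single place `𝔮`, subgroup form: `{}^⊥(G ⊓ 𝓛_𝔮) = G ⊔ 𝓛_𝔮`** for
`G = loc_𝔮(kummerOutside W (p^k) {𝔮})` — both `G` and `𝓛_𝔮` being their own annihilators under the
perfect `inv_𝔮(· ∪ₑ ·)` (`forall_mem_inf_iff_exists_add_of_self_annihilating`).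
[cite: MilneADT2006, Ch. I, Lemma 6.15] -/
theorem annLeft_inf_eq_sup (hK : ∀ w : InfinitePlace K, w.IsComplex)
    {inv : LocalInvariants K (p ^ k)} (hperf : inv.IsPerfect) (hsum : inv.SumLocalTermEqZero)
    (hcompl : inv.SelmerComplement)
    (hEuler : ∀ v : HeightOneSpectrum (𝓞 K),
      Nat.card (galoisCohomology ((W.torsionGaloisModule ((p ^ k : ℕ) : ℤ)).toLocal (Sum.inr v)) 1) =
        (Nat.card (nsmulAddMonoidHom (p ^ k) :
            (W.baseChange (v.adicCompletion K)).toAffine.Point →+ _).ker *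
          Nat.card (v.adicCompletionIntegers K ⧸
            Ideal.span {((p ^ k : ℕ) : v.adicCompletionIntegers K)})) ^ 2) :
    annLeft (invWeilPairing W (p ^ k) e hμ hadd₁ hadd₂ hgal inv (Sum.inr 𝔮))
        ((kummerOutside W (p ^ k) {Sum.inr 𝔮}).map
            (galoisCohomology.localization (W.torsionGaloisModule ((p ^ k : ℕ) : ℤ)) (Sum.inr 𝔮) 1) ⊓
          W.kummerSelmerStructure ((p ^ k : ℕ) : ℤ) (Sum.inr 𝔮)) =
      (kummerOutside W (p ^ k) {Sum.inr 𝔮}).map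
          (galoisCohomology.localization (W.torsionGaloisModule ((p ^ k : ℕ) : ℤ)) (Sum.inr 𝔮) 1) ⊔
        W.kummerSelmerStructure ((p ^ k : ℕ) : ℤ) (Sum.inr 𝔮) := by
  haveI := finite_galoisCohomology_toLocal_inr W (p ^ k) 𝔮
  have hA := nsmul_galoisCohomology_toLocal_eq_zero W (p ^ k) (Sum.inr 𝔮)
  have hbij := invWeilPairing_bijective W (p ^ k) e hμ hadd₁ hadd₂ hgal hnondeg inv 𝔮 (hperf 𝔮).1.1
  ext t
  rw [mem_annLeft_iff, AddSubgroup.mem_sup]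
  rw [forall_mem_inf_iff_exists_add_of_self_annihilating
    (invWeilPairing W (p ^ k) e hμ hadd₁ hadd₂ hgal inv (Sum.inr 𝔮)) hA hbij.1 _ _
    (forall_mem_map_kummerOutside_iff W p k e hμ hadd₁ hadd₂ hgal halt hnondeg 𝔮 hK hperf hsum hcompl hEuler)
    (forall_mem_kummer_invWeilPairing_eq_zero_iff W p k e hμ hadd₁ hadd₂ hgal halt hnondeg 𝔮
      (hperf 𝔮).1.1 (hEuler 𝔮)) t]

include e hμ hadd₁ hadd₂ hgal halt hnondeg in
/-- **THE EXACT RELAXATION INDEX** (the Poitou–Tate step "`#im α = #coker β`" of Jetchev–Skinner–Wan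
2017 Prop. 3.2.1 at finite level, EXACT).  For `E = W` elliptic over a number field `K` with all
infinite places complex, `n = p^k`, a finite place `𝔮`, a Poitou–Tate family `inv` at level `n`
(`IsPerfect`, `SumLocalTermEqZero`, `SelmerComplement`) and Tate's count `#H¹(K_v, E[n]) = #𝓛_v²` at
every finite `v`:

  `[kummerOutside W n {𝔮} : Sel⁽ⁿ⁾(E/K)] · #loc_𝔮(Sel⁽ⁿ⁾(E/K)) = #𝓛_𝔮`.

Proof: `Sel = KO ∩ loc_𝔮⁻¹𝓛_𝔮`, so `[KO : Sel] = [G ⊔ 𝓛_𝔮 : 𝓛_𝔮]` with `G = loc_𝔮 KO`;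
`G ⊔ 𝓛_𝔮 = {}^⊥(G ⊓ 𝓛_𝔮)` (`annLeft_inf_eq_sup`), `#{}^⊥(G ⊓ 𝓛_𝔮) · #(G ⊓ 𝓛_𝔮) = #H¹(K_𝔮, E[n]) = #𝓛_𝔮²`
(`natCard_annLeft_mul`), and `G ⊓ 𝓛_𝔮 = loc_𝔮 Sel`. Route p2's `relIndex_selmerGroup_kummerOutside_le` is
the `≤` against `[𝓛_𝔮 : loc_𝔮 κ E(K)]`. [cite: JetchevSkinnerWan2017, Prop. 3.2.1 (proof, arXiv:1512.06894 pp. 10–11)]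
[cite: MilneADT2006, Ch. I, Thm. 4.10(b), Cor. 2.3 and Lemma 6.15] -/
theorem relIndex_selmerGroup_kummerOutside_mul_natCard_map_eq (hK : ∀ w : InfinitePlace K, w.IsComplex)
    {inv : LocalInvariants K (p ^ k)} (hperf : inv.IsPerfect) (hsum : inv.SumLocalTermEqZero)
    (hcompl : inv.SelmerComplement)
    (hEuler : ∀ v : HeightOneSpectrum (𝓞 K),
      Nat.card (galoisCohomology ((W.torsionGaloisModule ((p ^ k : ℕ) : ℤ)).toLocal (Sum.inr v)) 1) =
        (Nat.card (nsmulAddMonoidHom (p ^ k) :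
            (W.baseChange (v.adicCompletion K)).toAffine.Point →+ _).ker *
          Nat.card (v.adicCompletionIntegers K ⧸
            Ideal.span {((p ^ k : ℕ) : v.adicCompletionIntegers K)})) ^ 2) :
    (W.selmerGroup ((p ^ k : ℕ) : ℤ)).relIndex (kummerOutside W (p ^ k) {Sum.inr 𝔮}) *
        Nat.card ((W.selmerGroup ((p ^ k : ℕ) : ℤ)).map
          (galoisCohomology.localization (W.torsionGaloisModule ((p ^ k : ℕ) : ℤ)) (Sum.inr 𝔮) 1)) =
      Nat.card (W.kummerSelmerStructure ((p ^ k : ℕ) : ℤ) (Sum.inr 𝔮)) := by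
  haveI hfin := finite_galoisCohomology_toLocal_inr W (p ^ k) 𝔮
  set loc := galoisCohomology.localization (W.torsionGaloisModule ((p ^ k : ℕ) : ℤ)) (Sum.inr 𝔮) 1
    with hloc
  set b := invWeilPairing W (p ^ k) e hμ hadd₁ hadd₂ hgal inv (Sum.inr 𝔮) with hb
  set L := W.kummerSelmerStructure ((p ^ k : ℕ) : ℤ) (Sum.inr 𝔮) with hL
  set KO := kummerOutside W (p ^ k) {Sum.inr 𝔮} with hKO
  set G := KO.map loc with hG
  set Sel := W.selmerGroup ((p ^ k : ℕ) : ℤ) with hSel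
  have hA := nsmul_galoisCohomology_toLocal_eq_zero W (p ^ k) (Sum.inr 𝔮)
  have hbij : Bijective b :=
    invWeilPairing_bijective W (p ^ k) e hμ hadd₁ hadd₂ hgal hnondeg inv 𝔮 (hperf 𝔮).1.1
  -- (1) `[KO : Sel] = [L ⊔ G : L]`
  have h1' : (L.comap loc ⊓ KO).relIndex KO = L.relIndex (L ⊔ G) := by
    rw [AddSubgroup.inf_relIndex_right, AddSubgroup.relIndex_comap, AddSubgroup.relIndex_sup_left]
  have h1 : Sel.relIndex KO = L.relIndex (L ⊔ G) := by
    rw [hSel, selmerGroup_eq_comap_inf_kummerOutside W p k 𝔮]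
    exact h1'
  -- (2) `loc Sel = G ⊓ L`
  have h2 : Sel.map loc = G ⊓ L := map_selmerGroup_eq_inf W p k 𝔮
  -- (3) `G ⊔ L = annLeft b (G ⊓ L)` and `#annLeft(G ⊓ L) · #(G ⊓ L) = #H¹`
  have h3 : annLeft b (G ⊓ L) = G ⊔ L :=
    annLeft_inf_eq_sup W p k e hμ hadd₁ hadd₂ hgal halt hnondeg 𝔮 hK hperf hsum hcompl hEuler
  have h4 : Nat.card (annLeft b (G ⊓ L)) * Nat.card ↥(G ⊓ L) =
      Nat.card (galoisCohomology ((W.torsionGaloisModule ((p ^ k : ℕ) : ℤ)).toLocal (Sum.inr 𝔮)) 1) :=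
    natCard_annLeft_mul hA b hbij (G ⊓ L)
  -- (4) `#H¹ = #L · #L`
  have hLcard : Nat.card L = Nat.card (nsmulAddMonoidHom (p ^ k) :
        (W.baseChange (𝔮.adicCompletion K)).toAffine.Point →+ _).ker *
      Nat.card (𝔮.adicCompletionIntegers K ⧸ Ideal.span {((p ^ k : ℕ) : 𝔮.adicCompletionIntegers K)}) :=
    W.natCard_kummerSelmerStructure_inr 𝔮 (NeZero.ne (p ^ k))
  have h5 : Nat.card (galoisCohomology ((W.torsionGaloisModule ((p ^ k : ℕ) : ℤ)).toLocal (Sum.inr 𝔮)) 1) =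
      Nat.card L * Nat.card L := by
    rw [hEuler 𝔮, hLcard, sq]
  -- (5) `[L ⊔ G : L] · #L = #(L ⊔ G)`
  have h6 : L.relIndex (L ⊔ G) * Nat.card L = Nat.card ↥(L ⊔ G) := by
    rw [AddSubgroup.relIndex, mul_comm,
      ← Nat.card_congr (AddSubgroup.addSubgroupOfEquivOfLe (le_sup_left : L ≤ L ⊔ G)).toEquiv]
    exact AddSubgroup.card_mul_index _
  -- combine
  have hLpos : 0 < Nat.card L := Nat.card_pos
  apply Nat.eq_of_mul_eq_mul_right hLpos
  rw [h1, h2]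
  calc L.relIndex (L ⊔ G) * Nat.card ↥(G ⊓ L) * Nat.card L
      = L.relIndex (L ⊔ G) * Nat.card L * Nat.card ↥(G ⊓ L) := by ring
    _ = Nat.card ↥(L ⊔ G) * Nat.card ↥(G ⊓ L) := by rw [h6]
    _ = Nat.card (annLeft b (G ⊓ L)) * Nat.card ↥(G ⊓ L) := by rw [h3, sup_comm]
    _ = Nat.card L * Nat.card L := by rw [h4, h5]

end OnePlace

/-! ## From the two named facts -/

/-- **THE EXACT RELAXATION INDEX from the NAMED FACTS** (Poitou–Tate for Selmer structures
`poitouTate_selmerStructure_duality K`, Howard 2.1.11 / Milne I 4.10(b); Tate's local Euler–Poincaré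
characteristic `localEulerPoincareCharacteristic K_v`, Milne I 2.8): for `E = W` elliptic over a
number field `K` with all infinite places complex, a prime `p`, `k ≥ 1`, and ANY finite place `𝔮`,

  `[kummerOutside W (p^k) {𝔮} : Sel^{(p^k)}(E/K)] · #loc_𝔮(Sel^{(p^k)}(E/K)) = #E(K_𝔮)[p^k] · #(𝓞_𝔮/p^k)`.

At a degree-one `𝔮 ∣ p` with `E(K_𝔮)[p] = 0` (route R1/p2: `𝔮 = 𝔭̄`, `K_𝔮 = ℚ_p`, erratum (iv)) the
right side is `p^k`; with `#loc_𝔮 Sel^{(p^k)} = p^{k−e}` at a deep level (multr1-p2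
`KummerTorsionDecomposition`) the relaxation index is EXACTLY `p^e` — the missing `≥` half of
JSW17 Prop. 3.2.1 at finite level. [cite: JetchevSkinnerWan2017, Prop. 3.2.1 (proof, arXiv:1512.06894 pp. 10–11)]
[cite: Howard2004HeegnerKolyvagin, Thm. 2.1.11 (arXiv:1202.6340 p. 6)] [cite: MilneADT2006, Ch. I, Thm. 2.8 and Thm. 4.10(b)] -/
theorem relIndex_selmerGroup_kummerOutside_mul_natCard_map_eq_of_facts
    (hK : ∀ w : InfinitePlace K, w.IsComplex) (hk : 0 < k)
    (hPT : poitouTate_selmerStructure_duality K)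
    (hEP : ∀ v : HeightOneSpectrum (𝓞 K), localEulerPoincareCharacteristic (v.adicCompletion K))
    (𝔮 : HeightOneSpectrum (𝓞 K)) :
    (W.selmerGroup ((p ^ k : ℕ) : ℤ)).relIndex (kummerOutside W (p ^ k) {Sum.inr 𝔮}) *
        Nat.card ((W.selmerGroup ((p ^ k : ℕ) : ℤ)).map
          (galoisCohomology.localization (W.torsionGaloisModule ((p ^ k : ℕ) : ℤ)) (Sum.inr 𝔮) 1)) =
      Nat.card (nsmulAddMonoidHom (p ^ k) :
          (W.baseChange (𝔮.adicCompletion K)).toAffine.Point →+ _).ker *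
        Nat.card (𝔮.adicCompletionIntegers K ⧸ Ideal.span {((p ^ k : ℕ) : 𝔮.adicCompletionIntegers K)}) := by
  have hprime : p.Prime := Fact.out
  have hpp : IsPrimePow (p ^ k) := ⟨p, k, hprime.prime, hk, rfl⟩
  have hp2 : 2 ≤ p ^ k := le_trans hprime.two_le (Nat.le_self_pow hk.ne' p)
  have hchar : ((p ^ k : ℕ) : K) ≠ 0 := Nat.cast_ne_zero.mpr (pow_ne_zero _ hprime.ne_zero)
  obtain ⟨e, hμ, hadd₁, hadd₂, halt, hnondeg, hgal⟩ := W.exists_weilPairing_holds (p ^ k) hp2 hchar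
  obtain ⟨inv, hperf, hsum, -, hcompl⟩ := hPT (p ^ k)
  have hEuler : ∀ v : HeightOneSpectrum (𝓞 K),
      Nat.card (galoisCohomology ((W.torsionGaloisModule ((p ^ k : ℕ) : ℤ)).toLocal (Sum.inr v)) 1) =
        (Nat.card (nsmulAddMonoidHom (p ^ k) :
            (W.baseChange (v.adicCompletion K)).toAffine.Point →+ _).ker *
          Nat.card (v.adicCompletionIntegers K ⧸
            Ideal.span {((p ^ k : ℕ) : v.adicCompletionIntegers K)})) ^ 2 := fun v ↦
    natCard_galoisCohomology_one_torsion_adicCompletion_eq_sq W v (p ^ k) hpp (hEP v)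
  rw [relIndex_selmerGroup_kummerOutside_mul_natCard_map_eq W p k e hμ hadd₁ hadd₂ hgal halt hnondeg 𝔮
    hK hperf hsum hcompl hEuler]
  exact W.natCard_kummerSelmerStructure_inr 𝔮 (NeZero.ne (p ^ k))

end Summit.BirchSwinnertonDyer.Rank1Residual.X11b.KummerPT

end
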